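import Summits.QuantumFields.BalabanUV.T4Continuum.Support.NE7BalabanSoftOperator
import Summits.QuantumFields.BalabanUV.T4Continuum.Support.NE7SliceLagrangeMultiplier
import Summits.QuantumFields.BalabanUV.T4Continuum.Support.NE7ConstrainedGreenBalabanGauge
import HarnessLib

/-!
# NE7ConstrainedGreenOnCarrier — F166 ON THE CARRIER: in the multi-level small-field class at a unitary periodic `W`, a skew periodic `X″` on Bałaban's straight slice
# `ker QbarIter_W` in the [B8] (1.38) gauge `IsLandauB8` that solves the slice equation `hess_W(X″, ·) = ⟨H, ·⟩` on the straight-tangent tests IS `C_a(W) H` — the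
# constrained Green operator `C = G − GQ*(QGQ*)⁻¹QG` of the CONCRETE soft operator `softOpK = Hess_W + D_W R(W) D_W* + M⁻² Qbar*Qbar` of F192 — for every left inverse
# `G` of `softOpK` and `(QGQ*)⁻¹` of `Q G Qbar*`; hence the SOURCE form of (KL-B) follows from TWO letters about concrete operators: invertibility ([B9] Thm 3.11 TYPE) and the
# sup-curl row of `C_a(W)` ([B9] Thm 3.3∕(3.49) TYPE) (file 122 of the curved (APE), F193)

Cell `pub-balaban`, rung (B)+1 sub-cell t4, lineage `b2b-balaban-t4-ne7-p1` (CRUX PROVER NE7 #1 = OWNER of row NE7), generation 85; memo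
`t4/b2b-balaban-t4-ne7-p1-g85/LAGRANGE-CARRIER.md` §3.  Over F192 `NE7BalabanSoftOperator` (the operators), F191 `NE7SliceLagrangeMultiplier.sliceEq_lagrangeForm` (the
multiplier), F166 `NE7ConstrainedGreenBalabanGauge.eq_source_of_gaugeFixed` (the abstract one-term transfer) and (140) `NE7ConstrainedGreenIdentity.constrainedGreen` BY NAME.
WHAT ([folklore]; 0 def, 0 sorry).  §1 `qbarOpK_eq_zero_iff` (the slice: `Qbar b = 0 ⟺ QbarIter L (j+1) W (extF b) ≡ 0`, by `N`-periodicity of the coarse field);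
§2 **`landauProj_adjoint_grad_eq_zero_iff`** (the gauge: `R(W)(D_W* b) = 0 ⟺ IsLandauB8 L N (j+1) W (extF b)` — (δ) of the docking memo on OUR side: B8's variational (1.38)
IS «`D*b ⊥ Δ_W N(Q′(W))`» IS «the orthogonal projection kills `D*b`»); §3 `hessOpK_eq_of_lagrangeForm` (the Lagrange form of F191 in operator language: `Hess_W b = h + Qbar* m`);
§4 **`resF_eq_constrainedGreen`** (MAIN: `resF X″ = C(resF H)` for every pair of left inverses `G`, `Dinv`); §5 **`sourceLetter_of_curlRow`** — F173's hypothesis `hSrc` at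
`Gauge := IsLandauB8` (constant `K`) from: a left inverse `G` of `softOpK` and `Dinv` of `Qbar G Qbar*` (EXISTENCE = [B9] Thm 3.11 TYPE) + the sup-curl row
`‖curl_W (extF (C h))‖ ≤ K‖extF h‖_∞` of `C = constrainedGreen G Qbar Qbar* Dinv` ([B9] Thm 3.3∕(3.49) TYPE).
HONEST FRAMING (page 1): finite-dimensional linear algebra and bookkeeping; NO estimate; the two letters of §5 are DISPLAYED HYPOTHESES about concrete operators, NOT proved,
and their identification with print's `Δ_a(U)`, `G(U)`, `(QGQ*)⁻¹` through lit-balaban's junction modules is NOT made here; nothing of Bałaban's asserted; (KL-B) at curved `W` NOT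
proved; (APE) on curved data NOT proved; NOT ONE-STEP, NOT NE7; spine 0∕9; finite T⁴ rung (B)+1 — NOT infinite volume, NOT mass gap, NOT `BetaPertH`, NOT Clay.  Continuum YM
on T⁴ ⇐ BetaPertH ∧ nine spine estimates (0/9 proved); BetaPertH ⇐ (D1) ∧ (D4) ∧ CAP+tail; G-an2-4 gates asym, D1 and NE2/3/4.
-/

set_option autoImplicit false

open scoped BigOperators InnerProductSpace Matrix Matrix.Norms.L2Operator
open Finset

namespace Summit.QuantumFields.BalabanUV.T4Continuum.NE7ConstrainedGreenOnCarrier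

open Literature.MathematicalPhysics.QuantumFieldTheory.Balaban1983to89
open B7Prop1Explicit B7Prop2Explicit UnitaryModel
open T4AveragingDeficitWall (IsUnitaryCfg IsSkewDir SmallField curlAt)
open T4AveragingDeficitWallBoundary (periodBox IsPeriodicCfg)
open AveragingDeficitPeriodicCounting (IsPeriodicDir)
open AveragingDeficitMultiLevelPrep (tower LevelSmall)
open AveragingDeficitMultiLevelBridge (tower_eq)
open MinimalActionLevels (perWin)
open BlockAveragePushDirGauge (gaugeDir)
open NE3HessForm (hess)
open NE3TangentCovariantTower (QbarIter)
open NE3FramePotBoundW (isPeriodicDir_QbarIter)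
open NE3CovariantCalculus (hsR)
open NE3HilbertSchmidtTorus
open NE3LandauOrbit (gaugeDir_skew)
open NE3CurvedCornerGaugeSpace (covDiv_mem_skewAdjoint)
open NE3.PairLandauB8 (IsLandauB8 avgKernelGauges covLapSite mem_avgKernelGauges_iff)
open NE3.LandauProjectionB8 (covDiv_gaugeDir_eq_covLapSite covLapSite_add_period)
open NE7FlatSliceSourceDuality (srcPair periodic_eq_boxVec_redN)
open NE7SliceLagrangeMultiplier (sliceEq_lagrangeForm apply_boxVec_eq_zero_of_resF_eq_zero)
open NE7ConstrainedGreenIdentity (constrainedGreen)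
open NE7ConstrainedGreenBalabanGauge (eq_source_of_gaugeFixed)
open NE7BalabanSoftOperator

noncomputable section

variable {d : ℕ} {n : Type*} [Fintype n] [DecidableEq n]

section Carrier

variable [Nonempty n] {L N : ℕ} [NeZero N] (hL : 1 ≤ L) (j : ℕ) [NeZero (N * L ^ (j + 1))]
  {W : Site d → Fin d → (Matrix n n ℂ)ˣ} {x : ℝ} (hWu : IsUnitaryCfg W) (hWP : IsPeriodicCfg W ((N * L ^ (j + 1) : ℕ) : ℤ))
  (hx : 0 ≤ x) (hs : LevelSmall d L j x) (hWx : SmallField W x)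

/-! ## §1 The slice: `Qbar b = 0 ⟺ QbarIter (extF b) ≡ 0` -/

include hWP in
/-- **BAŁABAN's SLICE ON THE CARRIER**: `qbarOpK b = 0 ⟺ QbarIter L (j+1) W (extF b) = 0` (the coarse field is `N`-periodic, so vanishing on the representatives is vanishing).
[folklore] -/
theorem qbarOpK_eq_zero_iff (b : skewForms d n (N * L ^ (j + 1))) :
    qbarOpK (N := N) hL j hWu hx hs hWx b = 0 ↔ QbarIter L (j + 1) W (extF (N * L ^ (j + 1)) (b : Form d n (N * L ^ (j + 1)))) = 0 := by
  constructor
  · intro hb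
    have hb0 : resF N (QbarIter L (j + 1) W (extF (N * L ^ (j + 1)) (b : Form d n (N * L ^ (j + 1))))) = 0 := by
      rw [← coe_qbarOpK hL j hWu hx hs hWx b, hb, Submodule.coe_zero]
    have htow : ((tower L N (j + 1) : ℕ) : ℤ) = ((N * L ^ (j + 1) : ℕ) : ℤ) := by rw [tower_eq]
    have hWP' : IsPeriodicCfg W ((tower L N (j + 1) : ℕ) : ℤ) := by rw [htow]; exact hWP
    have hbP : IsPeriodicDir (extF (N * L ^ (j + 1)) (b : Form d n (N * L ^ (j + 1)))) ((tower L N (j + 1) : ℕ) : ℤ) := by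
      rw [htow]; exact isPeriodicDir_extF _ _
    have hQP := isPeriodicDir_QbarIter L N (j + 1) hWP' hbP
    funext y κ
    rw [periodic_eq_boxVec_redN hQP y κ, apply_boxVec_eq_zero_of_resF_eq_zero N hb0]
    rfl
  · intro hb
    apply Subtype.ext
    rw [coe_qbarOpK, hb, Submodule.coe_zero]
    rfl

/-! ## §2 The gauge: `R(W)(D_W* b) = 0 ⟺ IsLandauB8 (extF b)` -/

omit [Nonempty n] [NeZero N] in
include hWu hWP in
/-- The restriction of `Δ_W μ`, `μ ∈ N(Q′(W))`, is a skew torus section (`W` unitary and periodic). [folklore] -/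
theorem resS_covLapSite_mem {μ : Site d → Matrix n n ℂ} (hμ : μ ∈ avgKernelGauges (d := d) (n := n) L N (j + 1) W) :
    resS (N * L ^ (j + 1)) (covLapSite W μ) ∈ skewSecs d n (N * L ^ (j + 1)) := by
  obtain ⟨hμs, hμP, -⟩ := mem_avgKernelGauges_iff.mp hμ
  refine resS_mem_skewSecs (fun y => ?_) (covLapSite_add_period hWP hμP)
  rw [← congrFun (covDiv_gaugeDir_eq_covLapSite W μ) y]
  exact covDiv_mem_skewAdjoint hWu (gaugeDir_skew hWu hμs) y

omit [Nonempty n] [NeZero N] in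
include hWP in
/-- The pairing of `IsLandauB8` read on the carrier: for `μ ∈ N(Q′(W))`, `⟪resS (Δ_W μ), D_W* b⟫ = Σ_{periodBox} Σ_κ hsR (extF b x κ) (gaugeDir W (Δ_W μ) x κ)`. [folklore] -/
theorem inner_resS_covLapSite_adjoint_grad {μ : Site d → Matrix n n ℂ} (hμ : μ ∈ avgKernelGauges (d := d) (n := n) L N (j + 1) W)
    (b : skewForms d n (N * L ^ (j + 1))) :
    ⟪(⟨resS (N * L ^ (j + 1)) (covLapSite W μ), resS_covLapSite_mem j hWu hWP hμ⟩ : skewSecs d n (N * L ^ (j + 1))),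
      (LinearMap.adjoint (𝕜 := ℝ) (E := skewSecs d n (N * L ^ (j + 1))) (F := skewForms d n (N * L ^ (j + 1))) (gradOpK hWu (N * L ^ (j + 1)))
          : skewForms d n (N * L ^ (j + 1)) →ₗ[ℝ] skewSecs d n (N * L ^ (j + 1))) b⟫_ℝ
      = ∑ y ∈ periodBox (d := d) (N * L ^ (j + 1)), ∑ κ : Fin d, hsR (extF (N * L ^ (j + 1)) (b : Form d n (N * L ^ (j + 1))) y κ) (gaugeDir W (covLapSite W μ) y κ) := by
  obtain ⟨-, hμP, -⟩ := mem_avgKernelGauges_iff.mp hμ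
  rw [LinearMap.adjoint_inner_right, real_inner_comm, inner_gradOpK_right, Submodule.coe_mk, extS_resS _ (covLapSite_add_period hWP hμP)]

omit [Nonempty n] [NeZero N] in
include hWP in
/-- **THE [B8] (1.38) GAUGE ON THE CARRIER — (δ) of the docking, OUR SIDE**: for a skew torus 1-form `b`, `landauProjK (D_W* b) = 0 ⟺ IsLandauB8 L N (j+1) W (extF b)` — the
orthogonal projection onto `Δ_W N(Q′(W))` kills the covariant divergence of `b` iff `b` is `hsR`-orthogonal to every `D_W Δ_W μ`, `μ ∈ N(Q′(W))`. [folklore] -/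
theorem landauProj_adjoint_grad_eq_zero_iff (b : skewForms d n (N * L ^ (j + 1))) :
    landauProjK L N (j + 1) W
        ((LinearMap.adjoint (𝕜 := ℝ) (E := skewSecs d n (N * L ^ (j + 1))) (F := skewForms d n (N * L ^ (j + 1))) (gradOpK hWu (N * L ^ (j + 1)))
            : skewForms d n (N * L ^ (j + 1)) →ₗ[ℝ] skewSecs d n (N * L ^ (j + 1))) b) = 0
      ↔ IsLandauB8 (d := d) L N (j + 1) W (extF (N * L ^ (j + 1)) (b : Form d n (N * L ^ (j + 1)))) := by
  set Dtb := (LinearMap.adjoint (𝕜 := ℝ) (E := skewSecs d n (N * L ^ (j + 1))) (F := skewForms d n (N * L ^ (j + 1))) (gradOpK hWu (N * L ^ (j + 1)))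
            : skewForms d n (N * L ^ (j + 1)) →ₗ[ℝ] skewSecs d n (N * L ^ (j + 1))) b with hDtb
  rw [landauProjK_apply_eq_zero_iff]
  constructor
  · intro horth μ hμ
    rw [← inner_resS_covLapSite_adjoint_grad j hWu hWP hμ b]
    have hmem : (⟨resS (N * L ^ (j + 1)) (covLapSite W μ), resS_covLapSite_mem j hWu hWP hμ⟩ : skewSecs d n (N * L ^ (j + 1)))
        ∈ {a : skewSecs d n (N * L ^ (j + 1)) | ∃ μ ∈ avgKernelGauges (d := d) (n := n) L N (j + 1) W,
            (a : Sec d n (N * L ^ (j + 1))) = resS (N * L ^ (j + 1)) (covLapSite W μ)} := ⟨μ, hμ, rfl⟩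
    exact Submodule.inner_right_of_mem_orthogonal (Submodule.subset_span hmem) horth
  · intro hLan
    rw [Submodule.mem_orthogonal]
    intro u hu
    induction hu using Submodule.span_induction with
    | mem a ha =>
        obtain ⟨μ, hμ, haμ⟩ := ha
        have hrepl : a = ⟨resS (N * L ^ (j + 1)) (covLapSite W μ), resS_covLapSite_mem j hWu hWP hμ⟩ := Subtype.ext haμ
        rw [hrepl, inner_resS_covLapSite_adjoint_grad j hWu hWP hμ b]
        exact hLan μ hμ
    | zero => exact inner_zero_left _
    | add a a' _ _ ha ha' => rw [inner_add_left, ha, ha', add_zero]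
    | smul t a _ ha => rw [real_inner_smul_left, ha, mul_zero]

/-! ## §3 The Lagrange form in operator language -/

/-- **`Hess_W b = h + Qbar* m`** from the Lagrange form of the slice equation (F191's output): if `hess W (extF b) Y = ⟨extF h, Y⟩ + ⟨extF m, QbarIter L (j+1) W Y⟩_{periodBox N}` for
every skew `(N·L^{j+1})`-periodic `Y`, then `hessOpK b = h + Qbar* m` in the skew torus 1-forms. [folklore] -/
theorem hessOpK_eq_of_lagrangeForm (b h : skewForms d n (N * L ^ (j + 1))) (m : skewForms d n N)
    (hlag : ∀ Y : Site d → Fin d → Matrix n n ℂ, IsSkewDir Y → IsPeriodicDir Y ((N * L ^ (j + 1) : ℕ) : ℤ) →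
      hess W (extF (N * L ^ (j + 1)) (b : Form d n (N * L ^ (j + 1)))) Y (perWin d (N * L ^ (j + 1)))
        = srcPair (extF (N * L ^ (j + 1)) (h : Form d n (N * L ^ (j + 1)))) Y (periodBox (d := d) (N * L ^ (j + 1)))
          + srcPair (extF N (m : Form d n N)) (QbarIter L (j + 1) W Y) (periodBox (d := d) N)) :
    hessOpK W (N * L ^ (j + 1)) b
      = h + (LinearMap.adjoint (𝕜 := ℝ) (E := skewForms d n (N * L ^ (j + 1))) (F := skewForms d n N) (qbarOpK (N := N) hL j hWu hx hs hWx)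
              : skewForms d n N →ₗ[ℝ] skewForms d n (N * L ^ (j + 1))) m := by
  refine ext_inner_right ℝ fun c => ?_
  rw [inner_hessOpK_left, inner_add_left, LinearMap.adjoint_inner_left, hlag _ c.2 (isPeriodicDir_extF _ _), Submodule.coe_inner, Submodule.coe_inner,
    inner_eq_sum_extF, coe_qbarOpK]
  congr 1
  conv_rhs => rw [← resF_extF N (m : Form d n N)]
  rw [inner_resF]
  rfl

/-! ## §4 MAIN: the gauge-fixed slice solution is `C_a(W) H` -/

include hWP in
/-- **F166 ON THE CARRIER.**  Let `X″` be skew `(N·L^{j+1})`-periodic, on Bałaban's straight slice (`QbarIter L (j+1) W X″ = 0`) and in the [B8] (1.38) gauge (`IsLandauB8`), solving the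
slice equation `hess W X″ Y = ⟨H, Y⟩` for every skew periodic straight-tangent `Y`, with `H` skew periodic.  Then for EVERY left inverse `G` of `softOpK` and EVERY left inverse
`Dinv` of `Qbar ∘ G ∘ Qbar*`: `resF X″ = constrainedGreen G Qbar Qbar* Dinv (resF H)` in the skew torus 1-forms — `X″ = C_a(W)H`. [folklore] -/
theorem resF_eq_constrainedGreen
    (G : skewForms d n (N * L ^ (j + 1)) →ₗ[ℝ] skewForms d n (N * L ^ (j + 1))) (hGS : ∀ y, G (softOpK hL j hWu hx hs hWx y) = y)
    (Dinv : skewForms d n N →ₗ[ℝ] skewForms d n N)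
    (hD' : ∀ f, Dinv (qbarOpK (N := N) hL j hWu hx hs hWx (G
      ((LinearMap.adjoint (𝕜 := ℝ) (E := skewForms d n (N * L ^ (j + 1))) (F := skewForms d n N) (qbarOpK (N := N) hL j hWu hx hs hWx)
          : skewForms d n N →ₗ[ℝ] skewForms d n (N * L ^ (j + 1))) f))) = f)
    {X'' H : Site d → Fin d → Matrix n n ℂ} (hXs : IsSkewDir X'') (hXP : IsPeriodicDir X'' ((N * L ^ (j + 1) : ℕ) : ℤ))
    (hXQ : QbarIter L (j + 1) W X'' = 0) (hXG : IsLandauB8 (d := d) L N (j + 1) W X'')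
    (hHs : IsSkewDir H) (hHP : IsPeriodicDir H ((N * L ^ (j + 1) : ℕ) : ℤ))
    (heq : ∀ Y : Site d → Fin d → Matrix n n ℂ, IsSkewDir Y → IsPeriodicDir Y ((N * L ^ (j + 1) : ℕ) : ℤ) → QbarIter L (j + 1) W Y = 0 →
      hess W X'' Y (perWin d (N * L ^ (j + 1))) = srcPair H Y (periodBox (d := d) (N * L ^ (j + 1)))) :
    (⟨resF (N * L ^ (j + 1)) X'', resF_mem_skewForms hXs⟩ : skewForms d n (N * L ^ (j + 1)))
      = constrainedGreen G (qbarOpK (N := N) hL j hWu hx hs hWx)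
          (LinearMap.adjoint (𝕜 := ℝ) (E := skewForms d n (N * L ^ (j + 1))) (F := skewForms d n N) (qbarOpK (N := N) hL j hWu hx hs hWx)
              : skewForms d n N →ₗ[ℝ] skewForms d n (N * L ^ (j + 1)))
          Dinv ⟨resF (N * L ^ (j + 1)) H, resF_mem_skewForms hHs⟩ := by
  -- the multiplier (F191)
  obtain ⟨μ, hμs, hμP, hμ⟩ := sliceEq_lagrangeForm hL j hWu hWP hx hs hWx (X'' := X'') (H := H) heq
  set b : skewForms d n (N * L ^ (j + 1)) := ⟨resF (N * L ^ (j + 1)) X'', resF_mem_skewForms hXs⟩ with hb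
  set h : skewForms d n (N * L ^ (j + 1)) := ⟨resF (N * L ^ (j + 1)) H, resF_mem_skewForms hHs⟩ with hh
  set m : skewForms d n N := ⟨resF N μ, resF_mem_skewForms hμs⟩ with hm
  have hbX : extF (N * L ^ (j + 1)) (b : Form d n (N * L ^ (j + 1))) = X'' := extF_resF _ hXP
  have hhH : extF (N * L ^ (j + 1)) (h : Form d n (N * L ^ (j + 1))) = H := extF_resF _ hHP
  have hmμ : extF N (m : Form d n N) = μ := extF_resF _ hμP
  -- the three hypotheses of F166
  have hsrc := hessOpK_eq_of_lagrangeForm hL j hWu hx hs hWx b h m (fun Y hYs hYP => by rw [hbX, hhH, hmμ]; exact hμ Y hYs hYP)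
  have hxQ : qbarOpK (N := N) hL j hWu hx hs hWx b = 0 := by rw [qbarOpK_eq_zero_iff hL j hWu hWP hx hs hWx, hbX]; exact hXQ
  have hgauge := (landauProj_adjoint_grad_eq_zero_iff j hWu hWP b).mpr (by rw [hbX]; exact hXG)
  exact eq_source_of_gaugeFixed (softOpK hL j hWu hx hs hWx) (hessOpK W (N * L ^ (j + 1))) G (qbarOpK (N := N) hL j hWu hx hs hWx)
    (LinearMap.adjoint (𝕜 := ℝ) (E := skewForms d n (N * L ^ (j + 1))) (F := skewForms d n N) (qbarOpK (N := N) hL j hWu hx hs hWx))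
    ((((L : ℝ) ^ (j + 1)) ^ 2)⁻¹ • LinearMap.id) Dinv (gradOpK hWu (N * L ^ (j + 1))) (landauProjK L N (j + 1) W)
    (LinearMap.adjoint (𝕜 := ℝ) (E := skewSecs d n (N * L ^ (j + 1))) (F := skewForms d n (N * L ^ (j + 1))) (gradOpK hWu (N * L ^ (j + 1))))
    (softOpK_apply hL j hWu hx hs hWx) hGS hD' hxQ hgauge hsrc

/-! ## §5 The SOURCE form of (KL-B) from two letters about the concrete operators -/

include hWP in
/-- **(KL-B) IN SOURCE FORM FROM [B9] Thm 3.11 + Thm 3.3∕(3.49) TYPE LETTERS ABOUT `softOpK`.**  HYPOTHESES (displayed, NOT proved): a left inverse `G` of Bałaban's soft operator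
`softOpK` on the skew torus 1-forms and a left inverse `Dinv` of `Qbar G Qbar*` (their EXISTENCE is the positivity row, [B9] Thm 3.11 TYPE), and the SUP-CURL ROW of the
constrained Green operator `C = G − G Qbar* Dinv Qbar G`: `‖curl_W (extF (C h)) (z; μ′ < ν′)‖ ≤ K·g` whenever `‖extF h‖_∞ ≤ g` ([B9] Thm 3.3 (gradient entries of `G`) + (3.49) TYPE).
CONCLUSION: F173's `hSrc` at `Gauge := IsLandauB8 L N (j+1) W` with constant `K` — every skew periodic gauge-fixed straight-tangent `X″` solving `hess_W(X″, ·) = ⟨H, ·⟩` on the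
straight-tangent tests with `‖H‖_∞ ≤ g` has `‖curl_W X″‖ ≤ K·g`. [folklore] -/
theorem sourceLetter_of_curlRow
    (G : skewForms d n (N * L ^ (j + 1)) →ₗ[ℝ] skewForms d n (N * L ^ (j + 1))) (hGS : ∀ y, G (softOpK hL j hWu hx hs hWx y) = y)
    (Dinv : skewForms d n N →ₗ[ℝ] skewForms d n N)
    (hD' : ∀ f, Dinv (qbarOpK (N := N) hL j hWu hx hs hWx (G
      ((LinearMap.adjoint (𝕜 := ℝ) (E := skewForms d n (N * L ^ (j + 1))) (F := skewForms d n N) (qbarOpK (N := N) hL j hWu hx hs hWx)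
          : skewForms d n N →ₗ[ℝ] skewForms d n (N * L ^ (j + 1))) f))) = f)
    {K : ℝ}
    (hC : ∀ h : skewForms d n (N * L ^ (j + 1)), ∀ g : ℝ, (∀ (y : Site d) (κ : Fin d), ‖extF (N * L ^ (j + 1)) (h : Form d n (N * L ^ (j + 1))) y κ‖ ≤ g) →
      ∀ (z : Site d) (μ' ν' : Fin d), μ' ≠ ν' →
        ‖curlAt W (extF (N * L ^ (j + 1)) ((constrainedGreen G (qbarOpK (N := N) hL j hWu hx hs hWx)
            (LinearMap.adjoint (𝕜 := ℝ) (E := skewForms d n (N * L ^ (j + 1))) (F := skewForms d n N) (qbarOpK (N := N) hL j hWu hx hs hWx)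
                : skewForms d n N →ₗ[ℝ] skewForms d n (N * L ^ (j + 1)))
            Dinv h : skewForms d n (N * L ^ (j + 1))) : Form d n (N * L ^ (j + 1)))) z μ' ν'‖ ≤ K * g) :
    ∀ X'' : Site d → Fin d → Matrix n n ℂ, IsSkewDir X'' → IsPeriodicDir X'' ((N * L ^ (j + 1) : ℕ) : ℤ) → QbarIter L (j + 1) W X'' = 0 →
      IsLandauB8 (d := d) L N (j + 1) W X'' →
      ∀ H : Site d → Fin d → Matrix n n ℂ, IsSkewDir H → IsPeriodicDir H ((N * L ^ (j + 1) : ℕ) : ℤ) → ∀ g : ℝ, 0 ≤ g → (∀ (y : Site d) (κ : Fin d), ‖H y κ‖ ≤ g) →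
      (∀ Y : Site d → Fin d → Matrix n n ℂ, IsSkewDir Y → IsPeriodicDir Y ((N * L ^ (j + 1) : ℕ) : ℤ) → QbarIter L (j + 1) W Y = 0 →
        hess W X'' Y (perWin d (N * L ^ (j + 1))) = srcPair H Y (periodBox (d := d) (N * L ^ (j + 1)))) →
      ∀ (z : Site d) (μ' ν' : Fin d), μ' ≠ ν' → ‖curlAt W X'' z μ' ν'‖ ≤ K * g := by
  intro X'' hXs hXP hXQ hXG H hHs hHP g _hg hHb heq z μ' ν' hne
  have hmain := resF_eq_constrainedGreen hL j hWu hWP hx hs hWx G hGS Dinv hD' hXs hXP hXQ hXG hHs hHP heq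
  have hX : X'' = extF (N * L ^ (j + 1)) ((constrainedGreen G (qbarOpK (N := N) hL j hWu hx hs hWx)
            (LinearMap.adjoint (𝕜 := ℝ) (E := skewForms d n (N * L ^ (j + 1))) (F := skewForms d n N) (qbarOpK (N := N) hL j hWu hx hs hWx)
                : skewForms d n N →ₗ[ℝ] skewForms d n (N * L ^ (j + 1)))
            Dinv ⟨resF (N * L ^ (j + 1)) H, resF_mem_skewForms hHs⟩ : skewForms d n (N * L ^ (j + 1))) : Form d n (N * L ^ (j + 1))) := by
    rw [← hmain, Submodule.coe_mk, extF_resF _ hXP]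
  rw [hX]
  exact hC _ g (fun y κ => by rw [Submodule.coe_mk, extF_resF _ hHP]; exact hHb y κ) z μ' ν' hne

end Carrier

end

end Summit.QuantumFields.BalabanUV.T4Continuum.NE7ConstrainedGreenOnCarrier
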